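import Mathlib.MeasureTheory.Measure.Prod
import Mathlib.MeasureTheory.Measure.Lebesgue.Complex
import Mathlib.MeasureTheory.Measure.Haar.NormedSpace
import Summits.CriticalPhenomena.CardyFormulaZ2.Theses.CardyFlipRusso
import Summits.CriticalPhenomena.CardyFormulaZ2.Theorems.CardyFlipRussoSquareFromVoronoiHubDefs
import Literature.Probability.Percolation.VoronoiCrossing
import Literature.Analysis.FunctionSpaces.PoissonPointProcess
import Literature.Analysis.FunctionSpaces.PoissonPointProcessExistence
import HarnessLib

/-!
# Vocabulary of the line `poisson-dilution-leg` for crux `SquareFromVoronoiHub`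
# (stmt-CriticalPhenomena-6434, route `CardyFlipRusso`, sub-problem `CardyFormulaZ2`)

DEFINITIONS MODULE of the line (lead `prover-line-stmt-CriticalPhenomena-6434-c5-0`, 2026-08-17;
line designed by the crux strategist `planner-cstrat-stmt-CriticalPhenomena-6434-p1-0`, skeleton
`Cruxes/SquareFromVoronoiHub/Lines/poisson_dilution_leg.lean`): the objects the skeleton posits, over
tree declarations only, so that the stub files `Theorems/CardyFlipRussoSquareFromVoronoiHubDilution*.lean`
can refer to them BY NAME, plus the KERNEL-CHECKED FACTORISATION of the crux through the line's three
statements (`squareFromVoronoiHub_of_dilutionLeg`, sorry-free glue).  Following the convention of the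
sibling modules `…ChessboardDefs` / `…ProductLegDefs` / `…DecimationDefs`, NO closed `Prop` is defined
here: the hypothesis end, the leg constancy (the single conjecture-grade statement of the line) and
the lattice end appear only as HYPOTHESES of the glue theorem.

THE LEG (strategist census `Cruxes/SquareFromVoronoiHub/STRATEGY-CENSUS.md` §6).  Parameter
`t ∈ [0,1]`.  Nuclei at parameter `t`: the lattice `ℤ²`, each site independently PRESENT with
probability `1 - t` and coloured by a fair coin; two independent Poisson processes of black and of
white nuclei of intensity `t · Lebesgue` each; HUB RULE (the landed centre-decimation identity (CD),
read backwards): at every point `p` of the plane with at least FOUR nearest nuclei (a Voronoi vertex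
of valency `≥ 4`) an independent fair coin indexed by `p ∈ ℚ²` decides which colour is joined THROUGH
`p` — the black region of the leg is the union of the closed black Voronoi cells minus the hubs whose
coin is not black (`legBlackRegion`).  At `t = 0` all lattice sites are present, the cells are the
closed unit squares about the sites of `ℤ²`, the hubs are exactly the face centres `ℤ² + (½,½)`, and
the connectivity of the black region is, face by face, that of site percolation on the centred
square lattice `G_s` (cells = `ℤ²`-sites, hub coins = centre sites): the LATTICE END, whose
vocabulary (`LatConfig`, `toLeg`, `latMeasure`, `latCrossing`, `latProb`, `hubCoin`, `latBlack`,
`gsConfig`) is the second half of this file.  At `t = 1` the lattice is a.s. empty, hubs a.s. do not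
occur, and the model is the crux's hypothesis model verbatim (`voronoiCrossingProb`).  For every `t`
the law (`legMeasure`) is `ℤ²`-periodic, `D₄`-invariant, colour-flip symmetric and positively
associated, and the family of laws does not depend on the mesh `δ`.

Sources: the strategist's census and line card (`Cruxes/SquareFromVoronoiHub/Lines/poisson_dilution_leg.md`);
Benjamini–Schramm, Comm. Math. Phys. 197 (1998) §1 (conformal invariance conjecture for Voronoi
percolation); Bollobás–Riordan, *Percolation* (2006), Ch. 8 §§8.1–8.2 (two-coloured Voronoi
tessellations, black-increasing events); Bálint–Camia–Meester, arXiv:0708.3349 §1.3 (constancy of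
crossing limits along one-parameter families of critical planar models is an instance of their
Conjecture 1.9 — it is the OPEN stub `stub_legConstancy` of the skeleton, never a fact).
-/

noncomputable section

open scoped Topology
open MeasureTheory Metric Set Filter
open Literature.Analysis.FunctionSpaces (PointConfig IsPoissonPointProcess
  existsUnique_isPoissonPointProcess_holds)
open Literature.Probability.Percolation (SiteConfig sitePercolation half blackRegion voronoiCrossing)
open Literature.Probability.RandomPlanarGeometry (ConformalRectangle cardyFunction crossRatio)
open Summit.CriticalPhenomena.CardyFormulaZ2.Cruxes.SquareFromVoronoiHub.VoronoiBlocks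
  (zGs Gs crudeCrossing siteCrossingProb voronoiCrossingProb squareFromVoronoiHub_iff)

namespace Summit.CriticalPhenomena.CardyFormulaZ2.Cruxes.SquareFromVoronoiHub.PoissonDilutionLeg

/-! ### The leg -/

/-- Position of the lattice site `x ∈ ℤ²` (`= zGs (Sum.inl x)`). [folklore] -/
def zZ2 (x : ℤ × ℤ) : ℂ := (x.1 : ℂ) + (x.2 : ℂ) * Complex.I

/-- Position of the rational point `q ∈ ℚ²` (index set of the hub coins). [folklore] -/
def zQ2 (q : ℚ × ℚ) : ℂ := ((q.1 : ℝ) : ℂ) + ((q.2 : ℝ) : ℂ) * Complex.I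

/-- `zZ2` is the left summand of the `G_s` position map `zGs`. [folklore] -/
@[simp] theorem zGs_inl (x : ℤ × ℤ) : zGs (Sum.inl x) = zZ2 x := rfl

/-- A configuration of the leg: ((Poisson black nuclei, Poisson white nuclei), (present lattice
sites, black lattice sites)), black hub coins. [folklore] -/
abbrev LegConfig : Type :=
  ((PointConfig ℂ × PointConfig ℂ) × (SiteConfig (ℤ × ℤ) × SiteConfig (ℤ × ℤ))) × SiteConfig (ℚ × ℚ)

/-- Black nuclei: the black Poisson points and the present lattice sites whose coin is black.
[folklore] -/
def blackNuclei (ω : LegConfig) : Set ℂ :=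
  (ω.1.1.1 : Set ℂ) ∪ zZ2 '' (ω.1.2.1 ∩ ω.1.2.2)

/-- White nuclei: the white Poisson points and the present lattice sites whose coin is white.
[folklore] -/
def whiteNuclei (ω : LegConfig) : Set ℂ :=
  (ω.1.1.2 : Set ℂ) ∪ zZ2 '' (ω.1.2.1 \ ω.1.2.2)

/-- All nuclei. [folklore] -/
def nuclei (ω : LegConfig) : Set ℂ := blackNuclei ω ∪ whiteNuclei ω

/-- The HUBS of the configuration (`Set`-valued, membership form): the points `p` such that at
least four nuclei realise the distance from `p` to the nucleus set (the Voronoi vertices where `≥ 4`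
closed cells meet). [folklore] -/
def hubs (ω : LegConfig) : Set ℂ :=
  {p | 4 ≤ ({n : ℂ | n ∈ nuclei ω ∧ dist p n = infDist p (nuclei ω)}).encard}

/-- The leg's black region: the closed black Voronoi cells (`blackRegion`, ties count as black),
minus the hubs whose coin is not black (a hub `p` is kept iff `p = zQ2 q` for some black coin `q`).
[cite: BollobasRiordan2006, Ch. 8 §8.1] -/
def legBlackRegion (ω : LegConfig) : Set ℂ :=
  blackRegion (blackNuclei ω) (whiteNuclei ω) \ {p | p ∈ hubs ω ∧ ∀ q ∈ ω.2, zQ2 q ≠ p}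

/-- The leg's crossing event of the conformal rectangle `R`, nuclei read at scale `δ`: a black path
in `closure Ω` from the arc `(ab)` to the arc `(cd)` (verbatim the shape of `voronoiCrossing`).
[cite: BollobasRiordan2006, Ch. 8 §8.2] -/
def legCrossing (R : ConformalRectangle) (δ : ℝ) : Set LegConfig :=
  {ω | ∃ x ∈ R.arc 0, ∃ y ∈ R.arc 2,
    JoinedIn (closure R.carrier ∩ {z | z / (δ : ℂ) ∈ legBlackRegion ω}) x y}

/-- The annealed law of the leg at parameter `t`: Poisson pair ⊗ (presence `Bernoulli(1-t)` ⊗ fair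
lattice coins) ⊗ fair hub coins.  Along the leg the Poisson pair `(PB, PW)` consists of two Poisson
laws of intensity `t · volume` (spelled out as two `IsPoissonPointProcess (ENNReal.ofReal t • volume)`
hypotheses wherever used; intensity `0` at `t = 0`, `volume` at `t = 1`). [folklore] -/
def legMeasure (t : unitInterval) (PB PW : Measure (PointConfig ℂ)) : Measure LegConfig :=
  ((PB.prod PW).prod
      ((sitePercolation (ℤ × ℤ) (unitInterval.symm t)).prod (sitePercolation (ℤ × ℤ) half))).prod
    (sitePercolation (ℚ × ℚ) half)

/-- Annealed crossing probability of the leg at parameter `t`, mesh `δ` (outer measure made real,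
like the crux's own `voronoiCrossingProb`). [cite: BollobasRiordan2006, Ch. 8 §8.2] -/
def legProb (t : unitInterval) (PB PW : Measure (PointConfig ℂ)) (R : ConformalRectangle) (δ : ℝ) : ℝ :=
  (legMeasure t PB PW).real (legCrossing R δ)

/-! ### The lattice end (`t = 0`): site percolation on `G_s` read as cells and hubs -/

/-- A configuration of the lattice end: (black lattice sites, black hub coins). [folklore] -/
abbrev LatConfig : Type := SiteConfig (ℤ × ℤ) × SiteConfig (ℚ × ℚ)

/-- The leg configuration of a lattice-end configuration: no Poisson nuclei, every site present.
[folklore] -/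
def toLeg (θ : LatConfig) : LegConfig := (((∅, ∅), (univ, θ.1)), θ.2)

/-- The law of the lattice end: fair lattice coins ⊗ fair hub coins. [folklore] -/
def latMeasure : Measure LatConfig :=
  (sitePercolation (ℤ × ℤ) half).prod (sitePercolation (ℚ × ℚ) half)

/-- The lattice-end crossing event of `R` at mesh `δ`: the leg's crossing event of the embedded
configuration. [folklore] -/
def latCrossing (R : ConformalRectangle) (δ : ℝ) : Set LatConfig :=
  {θ | toLeg θ ∈ legCrossing R δ}

/-- The lattice-end crossing probability of `R` at mesh `δ` (outer measure made real). [folklore] -/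
def latProb (R : ConformalRectangle) (δ : ℝ) : ℝ :=
  latMeasure.real (latCrossing R δ)

/-- The hub coin of the face `f` of `ℤ²`: the rational point `f + (½, ½)`, its centre. [folklore] -/
def hubCoin (f : ℤ × ℤ) : ℚ × ℚ := ((f.1 : ℚ) + 1 / 2, (f.2 : ℚ) + 1 / 2)

/-- The hub coin of the face `f` sits at the face centre `zGs (Sum.inr f)`. [folklore] -/
theorem zQ2_hubCoin (f : ℤ × ℤ) : zQ2 (hubCoin f) = zGs (Sum.inr f) := by
  simp only [zQ2, hubCoin, zGs, Sum.elim_inr]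
  push_cast
  ring

/-- `hubCoin` is injective. [folklore] -/
theorem hubCoin_injective : Function.Injective hubCoin := by
  intro f g h
  simp only [hubCoin, Prod.mk.injEq, add_left_inj, Int.cast_inj] at h
  exact Prod.ext h.1 h.2

/-- **The lattice-end black region, concretely** (lattice units): the union of the closed unit
squares about the black sites, minus the face centres whose hub coin is not black.  (That this IS
`legBlackRegion (toLeg θ)` when both colours occur is the dictionary stub of the skeleton.)
[folklore] -/
def latBlack (θ : LatConfig) : Set ℂ :=
  {z | ∃ v ∈ θ.1, |z.re - (v.1 : ℝ)| ≤ 1 / 2 ∧ |z.im - (v.2 : ℝ)| ≤ 1 / 2} \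
    {p | ∃ f : ℤ × ℤ, hubCoin f ∉ θ.2 ∧ p = zGs (Sum.inr f)}

/-- **The `G_s` site configuration of a lattice-end configuration**: a lattice vertex `Sum.inl v` is
open iff the site `v` is black, a centre vertex `Sum.inr f` is open iff the hub coin of the face `f`
is black. [folklore] -/
def gsConfig (θ : LatConfig) : SiteConfig ((ℤ × ℤ) ⊕ (ℤ × ℤ)) :=
  {y | Sum.elim (fun v : ℤ × ℤ => v ∈ θ.1) (fun f : ℤ × ℤ => hubCoin f ∈ θ.2) y}

/-- Membership of a lattice vertex in `gsConfig`. [folklore] -/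
@[simp] theorem inl_mem_gsConfig (θ : LatConfig) (v : ℤ × ℤ) : Sum.inl v ∈ gsConfig θ ↔ v ∈ θ.1 :=
  Iff.rfl

/-- Membership of a centre vertex in `gsConfig`. [folklore] -/
@[simp] theorem inr_mem_gsConfig (θ : LatConfig) (f : ℤ × ℤ) :
    Sum.inr f ∈ gsConfig θ ↔ hubCoin f ∈ θ.2 :=
  Iff.rfl

/-- The colour flip of the lattice end (all lattice coins and all hub coins complemented).
[folklore] -/
def latFlip (θ : LatConfig) : LatConfig := (θ.1ᶜ, θ.2ᶜ)

/-- The colour flip is an involution. [folklore] -/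
@[simp] theorem latFlip_latFlip (θ : LatConfig) : latFlip (latFlip θ) = θ := by
  simp [latFlip]

/-! ### Glue (sorry-free) -/

/-- ε/2: a function eventually uniformly close to a convergent one converges to the same limit.
[folklore] -/
theorem tendsto_of_eventually_abs_sub_le {f g : ℝ → ℝ} {l : Filter ℝ} {a : ℝ}
    (hf : Tendsto f l (𝓝 a)) (h : ∀ ε > (0 : ℝ), ∀ᶠ x in l, |f x - g x| ≤ ε) :
    Tendsto g l (𝓝 a) := by
  rw [Metric.tendsto_nhds] at hf ⊢
  intro ε hε
  filter_upwards [hf (ε / 2) (by positivity), h (ε / 2) (by positivity)] with x hx hx'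
  rw [Real.dist_eq] at hx ⊢
  calc |g x - a| ≤ |g x - f x| + |f x - a| := abs_sub_le _ _ _
    _ = |f x - g x| + |f x - a| := by rw [abs_sub_comm (g x) (f x)]
    _ < ε / 2 + ε / 2 := by linarith
    _ = ε := by ring

/-- Kingman: a Poisson process of Lebesgue intensity on `ℂ` exists. [cite: Kingman1993, §2.5] -/
theorem exists_isPoissonPointProcess_volume :
    ∃ P : Measure (PointConfig ℂ), IsPoissonPointProcess (volume : Measure ℂ) P := by
  obtain ⟨P, hP, -⟩ :=
    existsUnique_isPoissonPointProcess_holds (E := ℂ) (volume : Measure ℂ) (fun x => measure_singleton x)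
  exact ⟨P, hP⟩

/-- Kingman: a Poisson process of intensity zero on `ℂ` exists (it is the empty process).
[cite: Kingman1993, §2.5] -/
theorem exists_isPoissonPointProcess_zero :
    ∃ P : Measure (PointConfig ℂ), IsPoissonPointProcess (0 : Measure ℂ) P := by
  obtain ⟨P, hP, -⟩ :=
    existsUnique_isPoissonPointProcess_holds (E := ℂ) (0 : Measure ℂ) (fun x => by simp)
  exact ⟨P, hP⟩

/-- **The transfer through the Poisson-dilution leg** (kernel-checked glue, crux unfolded).  If
(H) under the crux's hypothesis the `t = 1` leg probabilities (Poisson pair of Lebesgue intensity) tend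
to Cardy's `F(η)` for every conformal rectangle (`h₁`, the HYPOTHESIS END — provable: at `t = 1` the
lattice is a.s. empty and hubs a.s. absent), (K) the leg probabilities are asymptotically constant in
`t`, uniformly on `[0,1]` and over the admissible Poisson pairs of intensity `t · volume` (`hK`, LEG
CONSTANCY — the single OPEN statement of the line, an instance of crossing universality along a
one-parameter family of critical planar models), and (E) Cardy for the `t = 0` leg probabilities
(Poisson pair of intensity ZERO) of every conformal rectangle implies Cardy for the crude site crossing
of `G_s` (`h₀`, the LATTICE END — provable: at `t = 0` the black region is the union of the black unit
cells minus the white-coined face centres, whose connectivity is that of `G_s`), then the crux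
`CardyFlipRusso.SquareFromVoronoiHub` holds.  Proof: the `t = 1` laws exist (Kingman); an `ε/2`
argument along `hK` between the parameters `1` and `0`. [folklore] -/
theorem dilutionLeg_transfer
    (h₁ : (∀ (PB PW : Measure (PointConfig ℂ)),
        IsPoissonPointProcess (volume : Measure ℂ) PB → IsPoissonPointProcess (volume : Measure ℂ) PW →
        ∀ R : ConformalRectangle, R.HasCrossingLimit (voronoiCrossingProb PB PW R) cardyFunction) →
      ∀ (PB PW : Measure (PointConfig ℂ)),
        IsPoissonPointProcess (volume : Measure ℂ) PB → IsPoissonPointProcess (volume : Measure ℂ) PW →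
        ∀ R : ConformalRectangle, R.HasCrossingLimit (legProb 1 PB PW R) cardyFunction)
    (hK : ∀ R : ConformalRectangle, ∀ ε > (0 : ℝ), ∀ᶠ δ in 𝓝[>] (0 : ℝ),
      ∀ (t t' : unitInterval) (PB PW PB' PW' : Measure (PointConfig ℂ)),
        IsPoissonPointProcess (ENNReal.ofReal (t : ℝ) • (volume : Measure ℂ)) PB →
        IsPoissonPointProcess (ENNReal.ofReal (t : ℝ) • (volume : Measure ℂ)) PW →
        IsPoissonPointProcess (ENNReal.ofReal (t' : ℝ) • (volume : Measure ℂ)) PB' →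
        IsPoissonPointProcess (ENNReal.ofReal (t' : ℝ) • (volume : Measure ℂ)) PW' →
          |legProb t PB PW R δ - legProb t' PB' PW' R δ| ≤ ε)
    (h₀ : (∀ (PB PW : Measure (PointConfig ℂ)),
        IsPoissonPointProcess (0 : Measure ℂ) PB → IsPoissonPointProcess (0 : Measure ℂ) PW →
        ∀ R : ConformalRectangle, R.HasCrossingLimit (legProb 0 PB PW R) cardyFunction) →
      ∀ R : ConformalRectangle, R.HasCrossingLimit (siteCrossingProb R) cardyFunction) :
    (∀ (PB PW : Measure (PointConfig ℂ)),
        IsPoissonPointProcess (volume : Measure ℂ) PB → IsPoissonPointProcess (volume : Measure ℂ) PW →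
        ∀ R : ConformalRectangle, R.HasCrossingLimit (voronoiCrossingProb PB PW R) cardyFunction) →
      ∀ R : ConformalRectangle, R.HasCrossingLimit (siteCrossingProb R) cardyFunction := by
  refine fun hV => h₀ ?_
  intro PB₀ PW₀ hPB₀ hPW₀ R φ x hφ
  obtain ⟨PB₁, hPB₁⟩ := exists_isPoissonPointProcess_volume
  obtain ⟨PW₁, hPW₁⟩ := exists_isPoissonPointProcess_volume
  have hlim₁ : Tendsto (legProb 1 PB₁ PW₁ R) (𝓝[>] 0) (𝓝 (cardyFunction (crossRatio x))) :=
    h₁ hV PB₁ PW₁ hPB₁ hPW₁ R φ x hφ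
  -- the laws in the form consumed by the constancy hypothesis
  have hPB₁' : IsPoissonPointProcess (ENNReal.ofReal ((1 : unitInterval) : ℝ) • (volume : Measure ℂ)) PB₁ := by
    simpa using hPB₁
  have hPW₁' : IsPoissonPointProcess (ENNReal.ofReal ((1 : unitInterval) : ℝ) • (volume : Measure ℂ)) PW₁ := by
    simpa using hPW₁
  have hPB₀' : IsPoissonPointProcess (ENNReal.ofReal ((0 : unitInterval) : ℝ) • (volume : Measure ℂ)) PB₀ := by
    simpa using hPB₀
  have hPW₀' : IsPoissonPointProcess (ENNReal.ofReal ((0 : unitInterval) : ℝ) • (volume : Measure ℂ)) PW₀ := by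
    simpa using hPW₀
  refine tendsto_of_eventually_abs_sub_le hlim₁ fun ε hε => ?_
  filter_upwards [hK R ε hε] with δ hδ
  exact hδ 1 0 PB₁ PW₁ PB₀ PW₀ hPB₁' hPW₁' hPB₀' hPW₀'

/-- **The crux factors through the Poisson-dilution leg, BY NAME**: hypothesis end, leg constancy and
lattice end give `CardyFlipRusso.SquareFromVoronoiHub` (`squareFromVoronoiHub_iff` + `dilutionLeg_transfer`).
[folklore] -/
theorem squareFromVoronoiHub_of_dilutionLeg
    (h₁ : (∀ (PB PW : Measure (PointConfig ℂ)),
        IsPoissonPointProcess (volume : Measure ℂ) PB → IsPoissonPointProcess (volume : Measure ℂ) PW →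
        ∀ R : ConformalRectangle, R.HasCrossingLimit (voronoiCrossingProb PB PW R) cardyFunction) →
      ∀ (PB PW : Measure (PointConfig ℂ)),
        IsPoissonPointProcess (volume : Measure ℂ) PB → IsPoissonPointProcess (volume : Measure ℂ) PW →
        ∀ R : ConformalRectangle, R.HasCrossingLimit (legProb 1 PB PW R) cardyFunction)
    (hK : ∀ R : ConformalRectangle, ∀ ε > (0 : ℝ), ∀ᶠ δ in 𝓝[>] (0 : ℝ),
      ∀ (t t' : unitInterval) (PB PW PB' PW' : Measure (PointConfig ℂ)),
        IsPoissonPointProcess (ENNReal.ofReal (t : ℝ) • (volume : Measure ℂ)) PB →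
        IsPoissonPointProcess (ENNReal.ofReal (t : ℝ) • (volume : Measure ℂ)) PW →
        IsPoissonPointProcess (ENNReal.ofReal (t' : ℝ) • (volume : Measure ℂ)) PB' →
        IsPoissonPointProcess (ENNReal.ofReal (t' : ℝ) • (volume : Measure ℂ)) PW' →
          |legProb t PB PW R δ - legProb t' PB' PW' R δ| ≤ ε)
    (h₀ : (∀ (PB PW : Measure (PointConfig ℂ)),
        IsPoissonPointProcess (0 : Measure ℂ) PB → IsPoissonPointProcess (0 : Measure ℂ) PW →
        ∀ R : ConformalRectangle, R.HasCrossingLimit (legProb 0 PB PW R) cardyFunction) →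
      ∀ R : ConformalRectangle, R.HasCrossingLimit (siteCrossingProb R) cardyFunction) :
    Summit.CriticalPhenomena.CardyFormulaZ2.Theses.CardyFlipRusso.SquareFromVoronoiHub :=
  squareFromVoronoiHub_iff.2 (dilutionLeg_transfer h₁ hK h₀)

/-- **Registered glue `stub_dilutionGlue`**: the crux factors through the three statements of the
line (hypothesis end, leg constancy, lattice end) — the statement of `dilutionLeg_transfer`
(the crux UNFOLDED by `squareFromVoronoiHub_iff`, so that in the skeleton only `SquareFromVoronoiHub_of`
concludes the route declaration by name). [folklore] -/
theorem stub_dilutionGlue : ((∀ (PB PW : Measure (PointConfig ℂ)),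
        IsPoissonPointProcess (volume : Measure ℂ) PB → IsPoissonPointProcess (volume : Measure ℂ) PW →
        ∀ R : ConformalRectangle, R.HasCrossingLimit (voronoiCrossingProb PB PW R) cardyFunction) →
      ∀ (PB PW : Measure (PointConfig ℂ)),
        IsPoissonPointProcess (volume : Measure ℂ) PB → IsPoissonPointProcess (volume : Measure ℂ) PW →
        ∀ R : ConformalRectangle, R.HasCrossingLimit (legProb 1 PB PW R) cardyFunction) →
    (∀ R : ConformalRectangle, ∀ ε > (0 : ℝ), ∀ᶠ δ in 𝓝[>] (0 : ℝ),
      ∀ (t t' : unitInterval) (PB PW PB' PW' : Measure (PointConfig ℂ)),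
        IsPoissonPointProcess (ENNReal.ofReal (t : ℝ) • (volume : Measure ℂ)) PB →
        IsPoissonPointProcess (ENNReal.ofReal (t : ℝ) • (volume : Measure ℂ)) PW →
        IsPoissonPointProcess (ENNReal.ofReal (t' : ℝ) • (volume : Measure ℂ)) PB' →
        IsPoissonPointProcess (ENNReal.ofReal (t' : ℝ) • (volume : Measure ℂ)) PW' →
          |legProb t PB PW R δ - legProb t' PB' PW' R δ| ≤ ε) →
    ((∀ (PB PW : Measure (PointConfig ℂ)),
        IsPoissonPointProcess (0 : Measure ℂ) PB → IsPoissonPointProcess (0 : Measure ℂ) PW →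
        ∀ R : ConformalRectangle, R.HasCrossingLimit (legProb 0 PB PW R) cardyFunction) →
      ∀ R : ConformalRectangle, R.HasCrossingLimit (siteCrossingProb R) cardyFunction) →
    ((∀ (PB PW : Measure (PointConfig ℂ)),
        IsPoissonPointProcess (volume : Measure ℂ) PB → IsPoissonPointProcess (volume : Measure ℂ) PW →
        ∀ R : ConformalRectangle, R.HasCrossingLimit (voronoiCrossingProb PB PW R) cardyFunction) →
      ∀ R : ConformalRectangle, R.HasCrossingLimit (siteCrossingProb R) cardyFunction) :=
  fun h₁ hK h₀ => dilutionLeg_transfer h₁ hK h₀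

end Summit.CriticalPhenomena.CardyFormulaZ2.Cruxes.SquareFromVoronoiHub.PoissonDilutionLeg

end
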